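import Summits.ValiantsHypothesis.ValiantsHypothesis.Theses.SchenstedIndex

/-!
# Degenerate slices of `SchenstedIndex.OneFactorisationBandLimit` (stmt-ValiantsHypothesis-16081)

Refuter bookkeeping (one-cycle crux attack; negative / small-model facts, no route item is asserted):

* `window_c_zero_empty`, `c_zero_slice` : the `c = 0` instance of the crux is vacuously true — its
  quasi-polynomial window `m + e ≤ 2 ^ ((Nat.log 2 m + 0) ^ 0) = 2` is empty once `m ≥ 3`;
* `window_nonempty` : for `c ≥ 1` the window contains `e = 0` for every `m`, so the crux has content
  exactly for `c ≥ 1` (and there at least at width `n = m`);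
* `oneOF_mem_span_t_zero` : multiplicity `t = 0` is never a witness — over the empty slot type the only
  admissible partition has no parts, so the 1-factorisation indicator and every block-cycle vector are
  the constant `1`;
* `oneOF_mem_span_m_zero` : `m = 0` is never a witness (same reason), so the conjunct `1 ≤ m` of the crux
  is logically redundant;
* `oneOF_mem_span_m_one` : `m = 1` is never a witness for any width `n ≥ 1` — the all-ones rank-one slot
  matrix reproduces `1_OF(t,1) = 1`; hence any proof of the crux must take `m ≥ 2` and `t ≥ 1`.

The slot-level terms below are the route's, verbatim, specialised at `t = 0`, `m = 0`, `m = 1`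
(with a free width `n` in place of `m + e`). [folklore]
-/

namespace Summit.ValiantsHypothesis.ValiantsHypothesis.Theorems.OneFactorisationBandLimit.Negative

-- summit = sub-problem name (single-conjunct summit, D-0017 layout), so the namespace repeats it
set_option linter.dupNamespace false

open scoped BigOperators Classical Matrix

/-- at `c = 0` the quasi-polynomial window `m + e ≤ 2 ^ ((Nat.log 2 m + 0) ^ 0) = 2` is empty once `m ≥ 3`. -/
theorem window_c_zero_empty (m e : ℕ) (hm : 3 ≤ m) : ¬ (m + e ≤ 2 ^ ((Nat.log 2 m + 0) ^ 0)) := by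
  rw [pow_zero, pow_one]; omega

/-- the `c = 0` instance of the crux body holds for ANY inner predicate (vacuous window). -/
theorem c_zero_slice (P : ℕ → ℕ → Prop) (m₀ : ℕ) :
    ∃ m : ℕ, m₀ ≤ m ∧ 1 ≤ m ∧ ∀ e : ℕ, m + e ≤ 2 ^ ((Nat.log 2 m + 0) ^ 0) → P m e :=
  ⟨m₀ + 3, by omega, by omega, fun e he => absurd he (window_c_zero_empty _ _ (by omega))⟩

/-- for `c ≥ 1` the window `m + e ≤ 2 ^ ((Nat.log 2 m + c) ^ c)` contains `e = 0`, for every `m`. -/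
theorem window_nonempty (c m : ℕ) (hc : 1 ≤ c) : m + 0 ≤ 2 ^ ((Nat.log 2 m + c) ^ c) := by
  have h1 : m < 2 ^ (Nat.log 2 m + 1) := Nat.lt_pow_succ_log_self (by norm_num) m
  have h2 : Nat.log 2 m + 1 ≤ (Nat.log 2 m + c) ^ c :=
    calc Nat.log 2 m + 1 ≤ Nat.log 2 m + c := by omega
      _ ≤ (Nat.log 2 m + c) ^ c := Nat.le_self_pow (by omega) _
  have h3 : 2 ^ (Nat.log 2 m + 1) ≤ 2 ^ ((Nat.log 2 m + c) ^ c) := Nat.pow_le_pow_right (by norm_num) h2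
  omega

/-- over an EMPTY slot type every finpartition of `univ` has no parts. -/
theorem parts_eq_empty_of_isEmpty {α : Type*} [Fintype α] [DecidableEq α] [IsEmpty α]
    (π : Finpartition (Finset.univ : Finset α)) : π.parts = ∅ := by
  rw [Finset.eq_empty_iff_forall_notMem]
  intro B hB
  exact π.ne_bot hB (Finset.eq_empty_of_isEmpty B)

/-- `t = 0` never witnesses: `1_OF(0,m) ∈ span_n(0,m)` for every `m, n`. -/
theorem oneOF_mem_span_t_zero (m n : ℕ) :
    (fun π : {π : Finpartition (Finset.univ : Finset (Fin 0 × Fin m × Fin m)) // ∀ B ∈ π.parts, B.card = m} =>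
      if (∀ B ∈ π.1.parts, (B.image fun s => s.2.1).card = m ∧ (B.image fun s => s.2.2).card = m)
      then (1 : ℂ) else 0) ∈
    Submodule.span ℂ (Set.range fun X : {X : Matrix (Fin 0 × Fin m × Fin m) (Fin 0 × Fin m × Fin m) ℂ //
        X.rank ≤ n} =>
      fun π : {π : Finpartition (Finset.univ : Finset (Fin 0 × Fin m × Fin m)) // ∀ B ∈ π.parts, B.card = m} =>
        ∏ B ∈ π.1.parts, ∑ q : Fin m ≃ ↥B, ∏ i : Fin m, X.1 (q i).1 (q (finRotate m i)).1) := by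
  apply Submodule.subset_span
  refine ⟨⟨0, by simp⟩, ?_⟩
  funext π
  have h := parts_eq_empty_of_isEmpty π.1
  simp [h]

/-- `m = 0` never witnesses: `1_OF(t,0) ∈ span_n(t,0)` for every `t, n` (so `1 ≤ m` is redundant in the crux). -/
theorem oneOF_mem_span_m_zero (t n : ℕ) :
    (fun π : {π : Finpartition (Finset.univ : Finset (Fin t × Fin 0 × Fin 0)) // ∀ B ∈ π.parts, B.card = 0} =>
      if (∀ B ∈ π.1.parts, (B.image fun s => s.2.1).card = 0 ∧ (B.image fun s => s.2.2).card = 0)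
      then (1 : ℂ) else 0) ∈
    Submodule.span ℂ (Set.range fun X : {X : Matrix (Fin t × Fin 0 × Fin 0) (Fin t × Fin 0 × Fin 0) ℂ //
        X.rank ≤ n} =>
      fun π : {π : Finpartition (Finset.univ : Finset (Fin t × Fin 0 × Fin 0)) // ∀ B ∈ π.parts, B.card = 0} =>
        ∏ B ∈ π.1.parts, ∑ q : Fin 0 ≃ ↥B, ∏ i : Fin 0, X.1 (q i).1 (q (finRotate 0 i)).1) := by
  apply Submodule.subset_span
  refine ⟨⟨0, by simp⟩, ?_⟩
  funext π
  have h := parts_eq_empty_of_isEmpty π.1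
  simp [h]

/-- `m = 1` never witnesses: `1_OF(t,1) ∈ span_n(t,1)` for every `t` and every width `n ≥ 1`
(witness: the all-ones slot matrix, of rank `≤ 1`). -/
theorem oneOF_mem_span_m_one (t n : ℕ) (hn : 1 ≤ n) :
    (fun π : {π : Finpartition (Finset.univ : Finset (Fin t × Fin 1 × Fin 1)) // ∀ B ∈ π.parts, B.card = 1} =>
      if (∀ B ∈ π.1.parts, (B.image fun s => s.2.1).card = 1 ∧ (B.image fun s => s.2.2).card = 1)
      then (1 : ℂ) else 0) ∈
    Submodule.span ℂ (Set.range fun X : {X : Matrix (Fin t × Fin 1 × Fin 1) (Fin t × Fin 1 × Fin 1) ℂ //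
        X.rank ≤ n} =>
      fun π : {π : Finpartition (Finset.univ : Finset (Fin t × Fin 1 × Fin 1)) // ∀ B ∈ π.parts, B.card = 1} =>
        ∏ B ∈ π.1.parts, ∑ q : Fin 1 ≃ ↥B, ∏ i : Fin 1, X.1 (q i).1 (q (finRotate 1 i)).1) := by
  apply Submodule.subset_span
  refine ⟨⟨Matrix.vecMulVec (fun _ => (1 : ℂ)) (fun _ => 1), le_trans (Matrix.rank_vecMulVec_le _ _) hn⟩, ?_⟩
  funext π
  have hB : ∀ B ∈ π.1.parts, ∃ s, B = {s} := fun B hB => Finset.card_eq_one.mp (π.2 B hB)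
  have h1 : ∀ B ∈ π.1.parts, (B.image fun s => s.2.1).card = 1 ∧ (B.image fun s => s.2.2).card = 1 := by
    intro B hBm
    obtain ⟨s, rfl⟩ := hB B hBm
    simp
  have h2 : ∀ B ∈ π.1.parts, (∑ q : Fin 1 ≃ ↥B, ∏ i : Fin 1,
      Matrix.vecMulVec (fun _ => (1 : ℂ)) (fun _ => 1) (q i).1 (q (finRotate 1 i)).1) = 1 := by
    intro B hBm
    obtain ⟨s, rfl⟩ := hB B hBm
    have e : Fin 1 ≃ ↥({s} : Finset (Fin t × Fin 1 × Fin 1)) :=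
      (Fintype.equivFinOfCardEq (by simp)).symm
    have hc : Fintype.card (Fin 1 ≃ ↥({s} : Finset (Fin t × Fin 1 × Fin 1))) = 1 := by
      rw [Fintype.card_eq_one_iff]
      refine ⟨e, fun q => Equiv.ext fun i => Subtype.ext ?_⟩
      exact (Finset.mem_singleton.mp (q i).2).trans (Finset.mem_singleton.mp (e i).2).symm
    have hq : ∀ q : Fin 1 ≃ ↥({s} : Finset (Fin t × Fin 1 × Fin 1)),
        (∏ i : Fin 1, Matrix.vecMulVec (fun _ => (1 : ℂ)) (fun _ => 1) (q i).1 (q (finRotate 1 i)).1) = 1 := by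
      intro q; simp [Matrix.vecMulVec_apply]
    rw [Finset.sum_congr rfl (fun q _ => hq q), Finset.sum_const, Finset.card_univ, hc]
    simp
  show (∏ B ∈ π.1.parts, ∑ q : Fin 1 ≃ ↥B, ∏ i : Fin 1,
      Matrix.vecMulVec (fun _ => (1 : ℂ)) (fun _ => 1) (q i).1 (q (finRotate 1 i)).1) = _
  rw [if_pos h1]
  exact Finset.prod_eq_one h2

end Summit.ValiantsHypothesis.ValiantsHypothesis.Theorems.OneFactorisationBandLimit.Negative
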